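import Summits.HubbardSuperconductivity.HubbardSuperconductivity.Theorems.AnisotropyChordStiffnessScaleBookkeeping

/-!
# Route `AnisotropyChord` / H0 rotor rung: the near/far PAIR BOUNDS behind stub D4 `KernelLipschitzAtScale`
# (theory seat memo ROTOR-THEORY-8 §122(d)/§123; Sketch8 Part S ported, first half)

The near/far split of the bond-pair identity `filteredForm_eq_kernel_sum`:
`G_Ω(k) − G_Ω(0) = Re Σ_{(b,b')} ε̄ⱼ ε_{j'} (φ_k(y−x) − 1) F_{bb'}`; pairs at torus distance `≤ R` use
`|φ_k(δ) − 1| ≤ 2|k|_T d_∞(δ)` (G2) and the kernel sup bound, the others `|φ − 1| ≤ 2` and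
`|F_{bb'}| = ½|F_{bb'} + F_{b'b}|` (K3) with the Lieb–Robinson bound K2, summed with the shell estimate G4.

This file: the torus distance `tdist`, the typed geometric stubs G2 `PhaseLipschitz`, G3 `BallCount`, G4 `FarExpSum`,
G5 `BondCurrentBound` (all elementary; discharged separately), the per-pair weight `pairWeight` and **`pairTerm_bound`**,
the per-site bound `perSiteBound` / `sum_pairWeight_le`, and the Schur-type pair sum `sum_pairs_le`.
Typing authority: theory seat `hubbard-h0-rotor-theory-1`, cycle 8.
-/

set_option linter.dupNamespace false

noncomputable section

open Matrix Complex Finset Filter Topology MeasureTheory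
open scoped ComplexConjugate
open Literature.MathematicalPhysics.QuantumLattice hiding torusPhase torusNorm
open Literature.Probability.LatticeModels
open Summit.HubbardSuperconductivity.HubbardSuperconductivity.Theorems.AnisotropyChord.InsertionEntropy

namespace Summit.HubbardSuperconductivity.HubbardSuperconductivity.Theorems.AnisotropyChord.Stiffness

/-- The periodic `ℓ^∞` distance on the `L × L` torus as a real number. -/
def tdist (L : ℕ) (x y : TorusSite 2 L) : ℝ := (torusDist (Ls := fun _ : Fin 2 => L) x y : ℝ)

/-- `tdist ≥ 0`. -/
theorem tdist_nonneg (L : ℕ) (x y : TorusSite 2 L) : 0 ≤ tdist L x y := Nat.cast_nonneg _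

/-- **STUB G2 — PHASE LIPSCHITZ BOUND** `|φ_k(y − x) − 1| ≤ 2|k|_T·d_∞(x,y)` (centred representatives:
`|2πk·δ/L| ≤ (2π/L)(|k₁||δ₁| + |k₂||δ₂|) ≤ 2|k|_T‖δ‖_∞`); size S, elementary — discharged separately. -/
def PhaseLipschitz : Prop :=
  ∀ (L : ℕ) [NeZero L] (k x y : TorusSite 2 L),
    ‖torusPhase L k (y - x) - 1‖ ≤ 2 * torusNorm L k * tdist L x y

/-- **STUB G3 — BALL COUNT** `#{y : d_∞(x,y) ≤ R} ≤ (2R+1)²` (per coordinate at most `min(L, 2R+1)` residues); size S, elementary — discharged separately. -/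
def BallCount : Prop :=
  ∀ (L : ℕ) [NeZero L] (x : TorusSite 2 L) (R : ℝ), 0 ≤ R →
    ((Finset.univ.filter fun y : TorusSite 2 L => tdist L x y ≤ R).card : ℝ) ≤ (2 * R + 1) ^ 2

/-- **STUB G4 — FAR EXPONENTIAL SHELL SUM** `Σ_{y : d_∞(x,y) > R} e^{−a d} ≤ 8e^{−aR}((R+1)(1 + 1/a) + 1/a²)`
(shells `#{d_∞ = r} ≤ 8r`; geometric series from the first integer `r₀ > R`, `r₀ ≤ R + 1`;
`1/(1−e^{−a}) ≤ 1 + 1/a`, `e^{a}/(e^{a}−1)² ≤ 1/a²`); size M, elementary — discharged separately. -/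
def FarExpSum : Prop :=
  ∀ (a : ℝ), 0 < a → ∀ (L : ℕ) [NeZero L] (x : TorusSite 2 L) (R : ℝ), 0 ≤ R →
    ∑ y ∈ Finset.univ.filter (fun y : TorusSite 2 L => ¬ tdist L x y ≤ R), Real.exp (-(a * tdist L x y))
      ≤ 8 * Real.exp (-(a * R)) * ((R + 1) * (1 + 1 / a) + 1 / a ^ 2)

/-- **STUB G5 — BOND CURRENT NORM** `‖j_{xy} w‖ ≤ ‖w‖` (`j = ½(S⁺S⁻ − h.c.)` has norm `½`; `1` suffices); size S, elementary — discharged separately. -/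
def BondCurrentBound : Prop :=
  ∀ (L : ℕ) [NeZero L] (x y : TorusSite 2 L) (w : (TorusSite 2 L → Fin 2) → ℂ),
    ‖WithLp.toLp 2 (bondCurrent L x y *ᵥ w)‖ ≤ ‖WithLp.toLp 2 w‖

/-- `‖ψ‖ = 1` for a Perron amplitude. -/
theorem norm_toC_eq_one (L : ℕ) [NeZero L] {Δ M : ℝ} {a : (TorusSite 2 L → Fin 2) → ℝ}
    (ha : IsPerronSectorGroundAmplitude L Δ M a) : ‖WithLp.toLp 2 (toC L a)‖ = 1 := by
  have h2 : ‖WithLp.toLp 2 (toC L a)‖ ^ 2 = 1 := by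
    rw [EuclideanSpace.norm_sq_eq]
    have : ∀ σ, ‖(WithLp.toLp 2 (toC L a)) σ‖ ^ 2 = a σ ^ 2 := by
      intro σ
      simp [toC, Complex.norm_real, sq_abs]
    simp_rw [this]
    exact ha.unit
  have h0 : 0 ≤ ‖WithLp.toLp 2 (toC L a)‖ := norm_nonneg _
  nlinarith [h2, h0]

/-- `‖εⱼ‖‖ε_{j'}‖ ≤ Σᵢ ‖εᵢ‖²`. -/
theorem norm_mul_norm_le_sum_sq (ε : Fin 2 → ℂ) (j j' : Fin 2) :
    ‖ε j‖ * ‖ε j'‖ ≤ ∑ i, ‖ε i‖ ^ 2 := by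
  have hj : ‖ε j‖ ^ 2 ≤ ∑ i, ‖ε i‖ ^ 2 :=
    Finset.single_le_sum (f := fun i => ‖ε i‖ ^ 2) (fun i _ => sq_nonneg _) (Finset.mem_univ j)
  have hj' : ‖ε j'‖ ^ 2 ≤ ∑ i, ‖ε i‖ ^ 2 :=
    Finset.single_le_sum (f := fun i => ‖ε i‖ ^ 2) (fun i _ => sq_nonneg _) (Finset.mem_univ j')
  nlinarith [sq_nonneg (‖ε j‖ - ‖ε j'‖), norm_nonneg (ε j), norm_nonneg (ε j')]

/-- The pair weight of the near/far split (near: phase Lipschitz × kernel sup bound; far: `2 ×` K2/2). -/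
def pairWeight (L : ℕ) [NeZero L] (Ω : ℝ) (k : TorusSite 2 L) (c v μ CLR R : ℝ) (x y : TorusSite 2 L) : ℝ :=
  if tdist L x y ≤ R then 2 * torusNorm L k * R / (2 * Ω)
  else c / Ω * (Real.exp (-(Ω * tdist L x y / (2 * v))) + CLR * Real.exp (-(μ * tdist L x y / 2)))

/-- `pairWeight ≥ 0` for `Ω > 0` and non-negative constants. -/
theorem pairWeight_nonneg (L : ℕ) [NeZero L] {Ω : ℝ} (hΩ : 0 < Ω) (k : TorusSite 2 L) {c v μ CLR R : ℝ}
    (hc : 0 ≤ c) (hCLR : 0 ≤ CLR) (hR : 0 ≤ R) (x y : TorusSite 2 L) :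
    0 ≤ pairWeight L Ω k c v μ CLR R x y := by
  unfold pairWeight
  split_ifs
  · have := torusNorm_nonneg (L := L) k
    positivity
  · positivity

/-- **Per-pair bound.** `|(c_p(k) − c_p(0)) F_p| ≤ ‖εⱼ‖‖ε_{j'}‖ · pairWeight(x,y)`. -/
theorem pairTerm_bound (L : ℕ) [NeZero L] (Δ M : ℝ) (a : (TorusSite 2 L → Fin 2) → ℝ)
    (hunit : ‖WithLp.toLp 2 (toC L a)‖ = 1) (Ω : ℝ) (hΩ : 0 < Ω) (k : TorusSite 2 L) (ε : Fin 2 → ℂ)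
    (hG2 : PhaseLipschitz) (hG5 : BondCurrentBound) {c v μ CLR : ℝ}
    (hfar : ∀ (x y : TorusSite 2 L) (j j' : Fin 2),
      ‖filteredKernel L Δ M a Ω x j y j' + filteredKernel L Δ M a Ω y j' x j‖
        ≤ c / Ω * (Real.exp (-(Ω * tdist L x y / (2 * v))) + CLR * Real.exp (-(μ * tdist L x y / 2))))
    (hsymm : ∀ (x : TorusSite 2 L) (j : Fin 2) (y : TorusSite 2 L) (j' : Fin 2),
      filteredKernel L Δ M a Ω x j y j' = filteredKernel L Δ M a Ω y j' x j)
    (R : ℝ) (hR : 0 ≤ R) (p : (TorusSite 2 L × Fin 2) × (TorusSite 2 L × Fin 2)) :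
    ‖(starRingEnd ℂ (ε p.1.2 * torusPhase L k p.1.1) * (ε p.2.2 * torusPhase L k p.2.1)
        - starRingEnd ℂ (ε p.1.2 * torusPhase L 0 p.1.1) * (ε p.2.2 * torusPhase L 0 p.2.1))
        * filteredKernel L Δ M a Ω p.1.1 p.1.2 p.2.1 p.2.2‖
      ≤ ‖ε p.1.2‖ * ‖ε p.2.2‖ * pairWeight L Ω k c v μ CLR R p.1.1 p.2.1 := by
  obtain ⟨⟨x, j⟩, ⟨y, j'⟩⟩ := p
  dsimp only
  -- the coefficient difference
  have hcoef : starRingEnd ℂ (ε j * torusPhase L k x) * (ε j' * torusPhase L k y)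
      - starRingEnd ℂ (ε j * torusPhase L 0 x) * (ε j' * torusPhase L 0 y)
      = starRingEnd ℂ (ε j) * ε j' * (torusPhase L k (y - x) - 1) := by
    rw [Summit.HubbardSuperconductivity.HubbardSuperconductivity.Theorems.AnisotropyChord.InsertionEntropy.torusPhase_zero_left, Summit.HubbardSuperconductivity.HubbardSuperconductivity.Theorems.AnisotropyChord.InsertionEntropy.torusPhase_zero_left,
      Summit.HubbardSuperconductivity.HubbardSuperconductivity.Theorems.AnisotropyChord.InsertionEntropy.torusPhase_sub_right, map_mul, map_mul]
    simp only [map_one, mul_one]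
    ring
  rw [hcoef]
  have hnorm : ‖starRingEnd ℂ (ε j) * ε j' * (torusPhase L k (y - x) - 1)
      * filteredKernel L Δ M a Ω x j y j'‖
      = ‖ε j‖ * ‖ε j'‖ * (‖torusPhase L k (y - x) - 1‖ * ‖filteredKernel L Δ M a Ω x j y j'‖) := by
    rw [norm_mul, norm_mul, norm_mul, Complex.norm_conj]
    ring
  rw [hnorm]
  have hεε : 0 ≤ ‖ε j‖ * ‖ε j'‖ := by positivity
  refine mul_le_mul_of_nonneg_left ?_ hεε
  -- kernel sup bound with unit vectors
  have hF0 : ‖filteredKernel L Δ M a Ω x j y j'‖ ≤ 1 / (2 * Ω) := by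
    have h := filteredKernel_lattice_norm_le L Δ M a Ω hΩ x j y j'
    have h1 := hG5 L x (x + Pi.single j 1) (toC L a)
    have h2 := hG5 L y (y + Pi.single j' 1) (toC L a)
    rw [hunit] at h1 h2
    calc ‖filteredKernel L Δ M a Ω x j y j'‖ ≤ _ := h
      _ ≤ 1 / (2 * Ω) * (1 * 1) := by
          apply mul_le_mul_of_nonneg_left _ (by positivity)
          exact mul_le_mul h1 h2 (norm_nonneg _) zero_le_one
      _ = 1 / (2 * Ω) := by ring
  unfold pairWeight
  split_ifs with hnear
  · -- near pair
    have hph : ‖torusPhase L k (y - x) - 1‖ ≤ 2 * torusNorm L k * R := by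
      calc ‖torusPhase L k (y - x) - 1‖ ≤ 2 * torusNorm L k * tdist L x y := hG2 L k x y
        _ ≤ 2 * torusNorm L k * R :=
            mul_le_mul_of_nonneg_left hnear (by have := torusNorm_nonneg (L := L) k; positivity)
    calc ‖torusPhase L k (y - x) - 1‖ * ‖filteredKernel L Δ M a Ω x j y j'‖
        ≤ (2 * torusNorm L k * R) * (1 / (2 * Ω)) :=
          mul_le_mul hph hF0 (norm_nonneg _) (by have := torusNorm_nonneg (L := L) k; positivity)
      _ = 2 * torusNorm L k * R / (2 * Ω) := by ring
  · -- far pair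
    have hph : ‖torusPhase L k (y - x) - 1‖ ≤ 2 := by
      calc ‖torusPhase L k (y - x) - 1‖ ≤ ‖torusPhase L k (y - x)‖ + ‖(1 : ℂ)‖ := norm_sub_le _ _
        _ = 2 := by rw [Summit.HubbardSuperconductivity.HubbardSuperconductivity.Theorems.AnisotropyChord.InsertionEntropy.norm_torusPhase, norm_one]; norm_num
    have hFfar : ‖filteredKernel L Δ M a Ω x j y j'‖
        ≤ 1 / 2 * (c / Ω * (Real.exp (-(Ω * tdist L x y / (2 * v)))
            + CLR * Real.exp (-(μ * tdist L x y / 2)))) := by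
      rw [norm_filteredKernel_eq_half_of_symm L Δ M a Ω x j y j' (hsymm x j y j')]
      exact mul_le_mul_of_nonneg_left (hfar x y j j') (by norm_num)
    have hpos : 0 ≤ 1 / 2 * (c / Ω * (Real.exp (-(Ω * tdist L x y / (2 * v)))
            + CLR * Real.exp (-(μ * tdist L x y / 2)))) := by
      have : 0 ≤ ‖filteredKernel L Δ M a Ω x j y j'‖ := norm_nonneg _
      linarith
    calc ‖torusPhase L k (y - x) - 1‖ * ‖filteredKernel L Δ M a Ω x j y j'‖
        ≤ 2 * (1 / 2 * (c / Ω * (Real.exp (-(Ω * tdist L x y / (2 * v)))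
            + CLR * Real.exp (-(μ * tdist L x y / 2))))) :=
          mul_le_mul hph hFfar (norm_nonneg _) (by norm_num)
      _ = c / Ω * (Real.exp (-(Ω * tdist L x y / (2 * v))) + CLR * Real.exp (-(μ * tdist L x y / 2))) := by
          ring

/-- The per-site bound of the near/far split (in the exponent conventions of D4 with `v ↦ 2v`, `μ ↦ μ/2`). -/
def perSiteBound (L : ℕ) [NeZero L] (Ω : ℝ) (k : TorusSite 2 L) (c v μ CLR R : ℝ) : ℝ :=
  (2 * R + 1) ^ 2 * (2 * torusNorm L k * R / (2 * Ω))
    + c / Ω * (8 * Real.exp (-(Ω * R / (2 * v))) * ((R + 1) * (1 + 1 / (Ω / (2 * v))) + 1 / (Ω / (2 * v)) ^ 2)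
      + CLR * (8 * Real.exp (-(μ / 2 * R)) * ((R + 1) * (1 + 1 / (μ / 2)) + 1 / (μ / 2) ^ 2)))

/-- Sum of the pair weights over `y` (G3 for the near ball, G4 twice for the far shells). -/
theorem sum_pairWeight_le (hG3 : BallCount) (hG4 : FarExpSum) (L : ℕ) [NeZero L] {Ω : ℝ} (hΩ : 0 < Ω)
    (k : TorusSite 2 L) {c v μ CLR R : ℝ} (hc : 0 ≤ c) (hv : 0 < v) (hμ : 0 < μ) (hCLR : 0 ≤ CLR)
    (hR : 0 ≤ R) (x : TorusSite 2 L) :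
    ∑ y, pairWeight L Ω k c v μ CLR R x y ≤ perSiteBound L Ω k c v μ CLR R := by
  unfold pairWeight perSiteBound
  rw [Finset.sum_ite]
  apply add_le_add
  · rw [Finset.sum_const, nsmul_eq_mul]
    have hnear : 0 ≤ 2 * torusNorm L k * R / (2 * Ω) := by
      have := torusNorm_nonneg (L := L) k; positivity
    exact mul_le_mul_of_nonneg_right (hG3 L x R hR) hnear
  · rw [← Finset.mul_sum, Finset.sum_add_distrib, ← Finset.mul_sum]
    apply mul_le_mul_of_nonneg_left _ (by positivity)
    have e1 : ∀ t : ℝ, Real.exp (-(Ω * t / (2 * v))) = Real.exp (-(Ω / (2 * v) * t)) :=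
      fun t => by congr 1; ring
    have e2 : ∀ t : ℝ, Real.exp (-(μ * t / 2)) = Real.exp (-(μ / 2 * t)) :=
      fun t => by congr 1; ring
    simp_rw [e1, e2]
    apply add_le_add
    · exact hG4 (Ω / (2 * v)) (by positivity) L x R hR
    · exact mul_le_mul_of_nonneg_left (hG4 (μ / 2) (by positivity) L x R hR) hCLR

/-- `Σ_pairs ‖εⱼ‖‖ε_{j'}‖ w(x,y) ≤ |ε|² · 4 Σ_{x,y} w(x,y)` (the two direction labels give the factor `4`). -/
theorem sum_pairs_le (L : ℕ) [NeZero L] (ε : Fin 2 → ℂ) (w : TorusSite 2 L → TorusSite 2 L → ℝ)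
    (hw : ∀ x y, 0 ≤ w x y) :
    ∑ p : (TorusSite 2 L × Fin 2) × (TorusSite 2 L × Fin 2), ‖ε p.1.2‖ * ‖ε p.2.2‖ * w p.1.1 p.2.1
      ≤ (∑ i, ‖ε i‖ ^ 2) * (4 * ∑ x, ∑ y, w x y) := by
  have hcount : ∑ p : (TorusSite 2 L × Fin 2) × (TorusSite 2 L × Fin 2), w p.1.1 p.2.1
      = 4 * ∑ x, ∑ y, w x y := by
    rw [Fintype.sum_prod_type]
    have h1 : ∀ a : TorusSite 2 L × Fin 2,
        ∑ b : TorusSite 2 L × Fin 2, w (a, b).1.1 (a, b).2.1 = 2 * ∑ y, w a.1 y := by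
      intro a
      rw [Fintype.sum_prod_type, Finset.mul_sum]
      refine Finset.sum_congr rfl fun y _ => ?_
      simp [Finset.sum_const, two_mul]
    simp_rw [h1]
    rw [Fintype.sum_prod_type]
    simp only [Finset.sum_const, Finset.card_univ, Fintype.card_fin, nsmul_eq_mul, Finset.mul_sum]
    refine Finset.sum_congr rfl fun x _ => Finset.sum_congr rfl fun y _ => ?_
    push_cast; ring
  calc ∑ p : (TorusSite 2 L × Fin 2) × (TorusSite 2 L × Fin 2), ‖ε p.1.2‖ * ‖ε p.2.2‖ * w p.1.1 p.2.1
      ≤ ∑ p : (TorusSite 2 L × Fin 2) × (TorusSite 2 L × Fin 2), (∑ i, ‖ε i‖ ^ 2) * w p.1.1 p.2.1 :=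
        Finset.sum_le_sum fun p _ => mul_le_mul_of_nonneg_right (norm_mul_norm_le_sum_sq ε _ _) (hw _ _)
    _ = (∑ i, ‖ε i‖ ^ 2) * (4 * ∑ x, ∑ y, w x y) := by rw [← Finset.mul_sum, hcount]

end Summit.HubbardSuperconductivity.HubbardSuperconductivity.Theorems.AnisotropyChord.Stiffness
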